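import Literature.NumberTheory.Rogawski1990.ArchExplicitTransferFactorCentralCurve      -- ★ G1 (F0P3a-p05 (g11)): `χ_g(u)`, `t`, `D_{G∕H,∞}`, `κ` along the central curve
import Literature.NumberTheory.Rogawski1990.ArchExplicitTransferFactorCurveSmooth       -- ★ p839780 (F0P3a-p05 (g10)): place factorisation of `μ_∞`, the place factors `F_w` differentiable off `0`
import Mathlib.Analysis.SpecialFunctions.Trigonometric.Bounds                           -- `Real.mul_le_sin` (Jordan)
import HarnessLib

/-!
# Rogawski's explicit archimedean factor along the CENTRAL one-angle curve — the analysis: `|τ| = 1`, `|∂_ψ τ| ≤ C∕|ψ|`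
# (Rogawski 1990 §14.5 Lemma 14.5.2 (c) p. 238 «the limit formula for `H` implies `f′^H(γ₀) = 0`»; §8.2 (8.2.1) p. 123: `μ⁻¹(z) = z|z|⁻¹(z∕z̄)^t`)

Topic `NumberTheory/Rogawski1990`; namespace `Literature.NumberTheory.Rogawski1990`.  THEOREMS ONLY (no definition, no named fact, no instance, no notation, no `sorry`).
Cell `pub/hodgecm-mathlib`, ENGINE T1 (crux H413 = `stmt-HodgeConjecture-24833`); floor-1½ preparation, count-neutral, under row (S-c) ∕ `stub_Sc` of the «SdArch» pay-down line
(`Cruxes/H413/Lines/F0_P3a_SdArch.lean`, `stub_ScCore`): brick **(R3-d) «CENTRAL-CURVE TWIN»**, FILE G2 of two (G1 = ★ `ArchExplicitTransferFactorCentralCurve`: the algebra), F0P3a-p02 (g10)'s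
R3 census 3fa90e6c §2 ∕ (M3) (LEAD F0P3a-plan (g9) T8-57 (B); author F0P3a-p05 (g11)).

THE MATHEMATICS ((M3) of the R3 census, factor part).  Along the central curve at `w₀` (only `w₀` moves, the other places sit at `(G,H)`-regular points; at `w₀` the base is central,
`a = b = u = ζ`), `τ(ψ) = μ_∞(u) · μ_∞(t(ψ))⁻¹` with `t(ψ)_{w₀} = 2cos(cψ) − 2 → 0` (★ G1) and `t(ψ)_w` constant off `w₀`: `μ_∞` is read ever closer to a NON-unit, so `τ` has no limit at
`ψ = 0`, but (i) `|τ(ψ)| = 1` for `cos(cψ) ≠ 1` when `μ` is UNITARY (the closer's `hμu : μ.IsUnitary`), and (ii) `|∂_ψ τ(ψ)| ≤ C∕|ψ|` near `0`: by the place factorisation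
`μ_∞(x) = Π_w F_w(x_w)` (★ `archHeckeValue_eq_prod_single`) only the factor `F_{w₀}(2cos(cψ) − 2)` moves; `F_{w₀}` restricted to `ℝ ∖ {0}` is a differentiable multiplicative function `g`, and
multiplicativity ALONE gives the homogeneity `r·g′(r) = g(r)·g′(1)` (differentiate `g(r s) = g(r)g(s)` at `s = 1`), hence `|g′(r)| = |g′(1)|∕|r|` under `|g| = 1` — no classification of the
characters of `ℂˣ` is used; so `|∂_ψ F_{w₀}(t(ψ))| = |g′(1)|·|2c sin(cψ)|∕(2 − 2cos(cψ)) = |g′(1)|·|c|·|sin x|∕(1 − cos x) ≤ |g′(1)|·|c|·π∕|x|` (`x = cψ`, `|x| ≤ π∕2`; `|sin x|∕(1−cos x) =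
(1 + cos x)∕|sin x| ≤ 2∕|sin x| ≤ π∕|x|` by Jordan's `(2∕π)|x| ≤ |sin x|`).  This is the `|∂τ| ≤ C∕|ψ|` that, against the compact-place flatness `d_G·Φ = O(ψ²)` ((R3-e)), makes every summand of
(vi) vanish with its derivative at the centre.

* §1 generic: **`norm_archHeckeValue_eq_one_of_isUnit`** (`‖μ_∞(x)‖ = 1` for unitary `μ`, unit `x`); **`ofReal_mul_deriv_eq_mul_deriv_one_of_map_mul`** (homogeneity `r·g′(r) = g(r)·g′(1)` for a
  multiplicative `g : ℝ → ℂ` differentiable off `0`), **`norm_deriv_eq_div_of_map_mul`** (`‖g′(r)‖ = ‖g′(1)‖∕|r|` under `‖g‖ = 1` off `0`); private `abs_sin_div_one_sub_cos_le`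
  (`|sin x|∕(1 − cos x) ≤ π∕|x|`, `0 < |x| ≤ π∕2`).
* §2 the place factor at `w₀`: `differentiableAt_archHeckeValue_single_ofReal` (`g_{w₀} = F_{w₀} ∘ ((↑) : ℝ → ℂ)` differentiable off `0`), `archHeckeValue_single_ofReal_mul` (multiplicative).
* §3 on the curve (binders of ★ G1; `hμu : μ.IsUnitary`): **`norm_archTau_centralCurve_eq_one`** (`‖τ(γ_H(ψ))‖ = 1` for `cos(c_{w₀}ψ) ≠ 1`), **`archHeckeValue_archTauArg_centralCurve_eq`** (the
  moving∕frozen split `μ_∞(t(ψ)) = K₀ · g_{w₀}(2cos(cψ) − 2)`), **`hasDerivAt_archTau_centralCurve`** (explicit derivative for `cos(cψ) ≠ 1`), and THE BOUND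
  **`norm_deriv_archTau_centralCurve_le`**: `∀ᶠ ψ in 𝓝[≠] 0, ‖deriv (ψ ↦ τ(γ_H(ψ))) ψ‖ ≤ (π · ‖g′_{w₀}(1)‖) ∕ |ψ|`.
HONEST LABEL: HC_CM is proved only modulo the printed citations until rung 0 closes; this file is calculus along a curve and pays nothing by itself.

## References
* [Rogawski1990] J. D. Rogawski, *Automorphic Representations of Unitary Groups in Three Variables*, Ann. of Math. Stud. 123 (1990): §14.5 Lemma 14.5.2 (c), p. 238; §8.2 (8.2.1) p. 123
  (`μ⁻¹(z) = z|z|⁻¹(z∕z̄)^t`); §4.9 p. 55 (`τ`).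
* [TateThesis1967] J. Tate, *Fourier analysis in number fields and Hecke's zeta-functions*, §2.3 (unitary characters, quasi-characters of `ℂˣ`).
-/

set_option autoImplicit false

noncomputable section

open NumberField NumberField.InfinitePlace Matrix Polynomial Filter Topology Complex
open scoped MatrixGroups Real

namespace Literature.NumberTheory.Rogawski1990

open Literature.NumberTheory.Automorphic
open Literature.NumberTheory.GaloisRepresentations

/-! ## §1 Generic: unitary values; homogeneity of multiplicative differentiable functions; a trigonometric bound -/

section Generic

variable (L : Type) [Field L] [NumberField L]

/-- **`‖μ_∞(x)‖ = 1` at every unit `x ∈ L ⊗ ℝ` when `μ` is UNITARY** (★ `HeckeCharacter.IsUnitary`: `‖μ(y)‖ = 1` on all idèles; `μ_∞(x)` IS such a value). [cite: TateThesis1967, §2.3] [cite: Rogawski1990, §4.9 p. 55] -/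
theorem norm_archHeckeValue_eq_one_of_isUnit {μ : HeckeCharacter L} (hμu : μ.IsUnitary) {x : mixedEmbedding.mixedSpace L} (hx : IsUnit x) :
    ‖archHeckeValue L μ x‖ = 1 := by
  classical
  unfold archHeckeValue
  rw [dif_pos hx]
  exact hμu _

omit [NumberField L] in
/-- **HOMOGENEITY FROM MULTIPLICATIVITY**: if `g : ℝ → ℂ` is multiplicative off `0` and differentiable off `0`, then `r · g′(r) = g(r) · g′(1)` for every `r ≠ 0` (differentiate `s ↦ g(r s) = g(r) g(s)` at
`s = 1`). [cite: TateThesis1967, §2.3] -/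
theorem ofReal_mul_deriv_eq_mul_deriv_one_of_map_mul {g : ℝ → ℂ} (hmul : ∀ a b : ℝ, a ≠ 0 → b ≠ 0 → g (a * b) = g a * g b)
    (hd : ∀ r : ℝ, r ≠ 0 → DifferentiableAt ℝ g r) {r : ℝ} (hr : r ≠ 0) : (r : ℂ) * deriv g r = g r * deriv g 1 := by
  -- `s ↦ g (r * s)` has derivative `r • g′(r)` at `s = 1` …
  have h1 : HasDerivAt (fun s : ℝ => g (r * s)) ((r : ℝ) • deriv g r) 1 := by
    have hg : HasDerivAt g (deriv g r) (r * 1) := by rw [mul_one]; exact (hd r hr).hasDerivAt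
    have hlin : HasDerivAt (fun s : ℝ => r * s) r 1 := by simpa using (hasDerivAt_id (1 : ℝ)).const_mul r
    exact hg.scomp 1 hlin
  -- … and equals `g r * g s` near `s = 1`, whose derivative there is `g r * g′(1)`
  have h2 : HasDerivAt (fun s : ℝ => g (r * s)) (g r * deriv g 1) 1 := by
    have hev : (fun s : ℝ => g r * g s) =ᶠ[𝓝 (1 : ℝ)] fun s => g (r * s) := by
      filter_upwards [isOpen_ne.mem_nhds (one_ne_zero : (1 : ℝ) ≠ 0)] with s hs
      rw [hmul r s hr hs]
    exact (((hd 1 one_ne_zero).hasDerivAt).const_mul (g r)).congr_of_eventuallyEq hev.symm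
  have h := h1.unique h2
  rw [Complex.real_smul] at h
  exact h

omit [NumberField L] in
/-- **`‖g′(r)‖ = ‖g′(1)‖ ∕ |r|`** for a multiplicative `g : ℝ → ℂ`, differentiable and of norm one off `0`. [cite: TateThesis1967, §2.3] -/
theorem norm_deriv_eq_div_of_map_mul {g : ℝ → ℂ} (hmul : ∀ a b : ℝ, a ≠ 0 → b ≠ 0 → g (a * b) = g a * g b)
    (hd : ∀ r : ℝ, r ≠ 0 → DifferentiableAt ℝ g r) (hn : ∀ r : ℝ, r ≠ 0 → ‖g r‖ = 1) {r : ℝ} (hr : r ≠ 0) : ‖deriv g r‖ = ‖deriv g 1‖ / |r| := by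
  have h := congrArg (fun z : ℂ => ‖z‖) (ofReal_mul_deriv_eq_mul_deriv_one_of_map_mul hmul hd hr)
  simp only [norm_mul, Complex.norm_real, Real.norm_eq_abs, hn r hr, one_mul] at h
  rw [eq_div_iff (abs_ne_zero.mpr hr), mul_comm]
  exact h

omit [NumberField L] in
/-- **`|sin x| ∕ (1 − cos x) ≤ π ∕ |x|` for `0 < |x| ≤ π∕2`** (`(1 − cos x)(1 + cos x) = sin² x`, so the quotient is `(1 + cos x)∕|sin x| ≤ 2∕|sin x|`, and Jordan's `(2∕π)|x| ≤ |sin x|`,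
Mathlib `Real.mul_le_sin`). [folklore] -/
private theorem abs_sin_div_one_sub_cos_le {x : ℝ} (hx0 : x ≠ 0) (hx : |x| ≤ π / 2) : |Real.sin x| / (1 - Real.cos x) ≤ π / |x| := by
  have hxpos : 0 < |x| := abs_pos.mpr hx0
  have hπ := Real.pi_pos
  -- `|sin x| = sin |x| ≥ (2/π)|x| > 0`
  have habs : |Real.sin x| = Real.sin |x| := by
    have hxpi : |x| ≤ π := hx.trans (by linarith)
    rcases le_or_gt 0 x with h | h
    · rw [abs_of_nonneg h] at hxpi ⊢
      exact abs_of_nonneg (Real.sin_nonneg_of_nonneg_of_le_pi h hxpi)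
    · rw [abs_of_neg h] at hxpi ⊢
      have hst : 0 ≤ Real.sin (-x) := Real.sin_nonneg_of_nonneg_of_le_pi (by linarith) hxpi
      rw [show Real.sin x = -Real.sin (-x) by rw [Real.sin_neg, neg_neg], abs_neg, abs_of_nonneg hst]
  have hsin : 2 / π * |x| ≤ |Real.sin x| := by rw [habs]; exact Real.mul_le_sin hxpos.le hx
  have h2pix : 0 < 2 / π * |x| := by positivity
  have hsin_pos : 0 < |Real.sin x| := lt_of_lt_of_le h2pix hsin
  have hs2 : 0 < Real.sin x ^ 2 := by rw [← sq_abs]; exact pow_pos hsin_pos 2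
  have hpyth := Real.sin_sq_add_cos_sq x
  have hcos1 : 0 < 1 - Real.cos x := by nlinarith [Real.cos_le_one x, Real.neg_one_le_cos x]
  -- the quotient as `(1 + cos x) / |sin x|`
  have hq : |Real.sin x| / (1 - Real.cos x) = (1 + Real.cos x) / |Real.sin x| := by
    rw [div_eq_div_iff hcos1.ne' hsin_pos.ne', ← sq, sq_abs]
    nlinarith [hpyth]
  rw [hq]
  calc (1 + Real.cos x) / |Real.sin x| ≤ 2 / |Real.sin x| := by
        apply div_le_div_of_nonneg_right _ hsin_pos.le
        linarith [Real.cos_le_one x]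
    _ ≤ 2 / (2 / π * |x|) := div_le_div_of_nonneg_left (by norm_num) h2pix hsin
    _ = π / |x| := by field_simp

end Generic

/-! ## §2 The place factor `F_w` on the real line -/

section Single

variable (L : Type) [Field L] [NumberField L] (μ : HeckeCharacter L) (w : {w : InfinitePlace L // IsComplex w})

open scoped Classical in
omit [NumberField L] in
/-- The single-place insertion `ι_w z` is a unit of `L ⊗ ℝ` for `z ≠ 0`. [folklore] -/
private theorem isUnit_single' {z : ℂ} (hz : z ≠ 0) : IsUnit (((fun _ => 1, Pi.mulSingle w z) : mixedEmbedding.mixedSpace L)) := by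
  rw [Prod.isUnit_iff, Pi.isUnit_iff, Pi.isUnit_iff]
  refine ⟨fun _ => isUnit_one, fun w' => ?_⟩
  dsimp only
  by_cases h : w' = w
  · subst h; rw [Pi.mulSingle_eq_same]; exact isUnit_iff_ne_zero.2 hz
  · rw [Pi.mulSingle_eq_of_ne h]; exact isUnit_one

open scoped Classical in
/-- **The place factor restricted to the reals, `g_w(r) = μ_∞(ι_w r)`, is multiplicative off `0`** (★ `archHeckeValue_single_mul`). [cite: TateThesis1967, §2.3] -/
theorem archHeckeValue_single_ofReal_mul {r r' : ℝ} (hr : r ≠ 0) (hr' : r' ≠ 0) :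
    archHeckeValue L μ (((fun _ => 1, Pi.mulSingle w (((r * r' : ℝ) : ℂ))) : mixedEmbedding.mixedSpace L)) =
      archHeckeValue L μ (((fun _ => 1, Pi.mulSingle w ((r : ℂ))) : mixedEmbedding.mixedSpace L)) *
        archHeckeValue L μ (((fun _ => 1, Pi.mulSingle w ((r' : ℂ))) : mixedEmbedding.mixedSpace L)) := by
  rw [Complex.ofReal_mul]
  exact archHeckeValue_single_mul L μ w (Complex.ofReal_ne_zero.mpr hr) (Complex.ofReal_ne_zero.mpr hr')

open scoped Classical in
/-- **`g_w` is differentiable off `0`** (★ `differentiableAt_archHeckeValue_single` composed with `(↑) : ℝ → ℂ`). [cite: Rogawski1990, §8.2 p. 123] [cite: TateThesis1967, §2.3] -/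
theorem differentiableAt_archHeckeValue_single_ofReal {r : ℝ} (hr : r ≠ 0) :
    DifferentiableAt ℝ (fun r : ℝ => archHeckeValue L μ (((fun _ => 1, Pi.mulSingle w ((r : ℂ))) : mixedEmbedding.mixedSpace L))) r :=
  DifferentiableAt.comp (𝕜 := ℝ) r (g := fun z : ℂ => archHeckeValue L μ (((fun _ => 1, Pi.mulSingle w z) : mixedEmbedding.mixedSpace L)))
    (differentiableAt_archHeckeValue_single L μ w (Complex.ofReal_ne_zero.mpr hr)) Complex.ofRealCLM.differentiableAt

open scoped Classical in
/-- `‖F_w(z)‖ = 1` for `z ≠ 0` when `μ` is unitary. [cite: TateThesis1967, §2.3] -/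
theorem norm_archHeckeValue_single_eq_one (hμu : μ.IsUnitary) {z : ℂ} (hz : z ≠ 0) :
    ‖archHeckeValue L μ (((fun _ => 1, Pi.mulSingle w z) : mixedEmbedding.mixedSpace L))‖ = 1 :=
  norm_archHeckeValue_eq_one_of_isUnit L hμu (isUnit_single' L w hz)

open scoped Classical in
/-- **`‖g_w′(r)‖ = ‖g_w′(1)‖ ∕ |r|`** off `0` for unitary `μ` (§1 homogeneity). [cite: Rogawski1990, §8.2 p. 123] [cite: TateThesis1967, §2.3] -/
theorem norm_deriv_archHeckeValue_single_ofReal (hμu : μ.IsUnitary) {r : ℝ} (hr : r ≠ 0) :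
    ‖deriv (fun r : ℝ => archHeckeValue L μ (((fun _ => 1, Pi.mulSingle w ((r : ℂ))) : mixedEmbedding.mixedSpace L))) r‖ =
      ‖deriv (fun r : ℝ => archHeckeValue L μ (((fun _ => 1, Pi.mulSingle w ((r : ℂ))) : mixedEmbedding.mixedSpace L))) 1‖ / |r| :=
  norm_deriv_eq_div_of_map_mul (fun _ _ ha hb => archHeckeValue_single_ofReal_mul L μ w ha hb)
    (fun _ hr => differentiableAt_archHeckeValue_single_ofReal L μ w hr) (fun _ hr => norm_archHeckeValue_single_eq_one L μ w hμu (Complex.ofReal_ne_zero.mpr hr)) hr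

end Single

/-! ## §3 `τ` along the central curve: unit modulus, the moving∕frozen split, the derivative bound -/

section Curve

variable (L : Type) [Field L] [NumberField L] [IsCMField L] (α : Fin 3 → L)
  (z₀ : {w : InfinitePlace L // IsComplex w} → Fin 3 → Circle) (c : {w : InfinitePlace L // IsComplex w} → ℝ)
  (γH : ℝ →
    ↥(UnitaryGroup.arch (↥(maximalRealSubfield L)) L (IsCMField.complexConj L) 2
        (Matrix.of fun i j : Fin 2 => if i.val + j.val + 1 = 2 then (1 : L) else 0)) ×
      ↥(UnitaryGroup.arch (↥(maximalRealSubfield L)) L (IsCMField.complexConj L) 1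
        (Matrix.of fun i j : Fin 1 => if i.val + j.val + 1 = 1 then (1 : L) else 0)))
  (γG : ℝ → ↥(UnitaryGroup.arch (↥(maximalRealSubfield L)) L (IsCMField.complexConj L) 3 (Matrix.diagonal α)))
  (hγH : γH = fun ψ =>
    ((UnitaryGroup.archPiEquivCM 2 L (Matrix.of fun i j : Fin 2 => if i.val + j.val + 1 = 2 then (1 : L) else 0)).symm fun w =>
        ⟨Matrix.GeneralLinearGroup.mkOfDetNeZero !![(1 : ℂ), 1; 1, -1] UnitaryGroup.det_cayleyTwo_ne_zero *
            UnitaryGroup.circleDiagonal 2 ![z₀ w 0 * Circle.exp (![(1 : ℝ), 0, -1] 0 * (c w * ψ)), z₀ w 2 * Circle.exp (![(1 : ℝ), 0, -1] 2 * (c w * ψ))] *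
          (Matrix.GeneralLinearGroup.mkOfDetNeZero !![(1 : ℂ), 1; 1, -1] UnitaryGroup.det_cayleyTwo_ne_zero)⁻¹,
          UnitaryGroup.cayley_conj_circleDiagonal_mem_archLocal L w _⟩,
      (UnitaryGroup.archPiEquivCM 1 L (Matrix.of fun i j : Fin 1 => if i.val + j.val + 1 = 1 then (1 : L) else 0)).symm fun w =>
        ⟨UnitaryGroup.circleDiagonal 1 ![z₀ w 1 * Circle.exp (![(1 : ℝ), 0, -1] 1 * (c w * ψ))],
          UnitaryGroup.circleDiagonal_mem_archLocal_antidiagOne L w _⟩))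
  (hγG : γG = fun ψ => UnitaryGroup.archDiagTorus L 3 α fun w i => z₀ w i * Circle.exp (![(1 : ℝ), 0, -1] i * (c w * ψ)))

  (w₀ : {w : InfinitePlace L // IsComplex w}) (μ : HeckeCharacter L)

include hγH in
/-- **`|τ(γ_H(ψ))| = 1` for `cos(c_{w₀}ψ) ≠ 1`** when `μ` is unitary: `τ = μ_∞(u)·μ_∞(t)⁻¹` with both arguments units (★ `isUnit_archGammaTwo`, ★ G1 `isUnit_archTauArg_centralCurve_of_cos_ne_one`).
[cite: Rogawski1990, §4.9 p. 55 («`|τ(γ)| = 1`»)] -/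
theorem norm_archTau_centralCurve_eq_one (hμu : μ.IsUnitary) (hc : ∀ w, w ≠ w₀ → c w = 0) (hcen : z₀ w₀ 0 = z₀ w₀ 1 ∧ z₀ w₀ 2 = z₀ w₀ 1)
    (hreg : ∀ w, w ≠ w₀ → z₀ w 1 ≠ z₀ w 0 ∧ z₀ w 1 ≠ z₀ w 2) {ψ : ℝ} (hψ : Real.cos (c w₀ * ψ) ≠ 1) :
    ‖archTau L (γH ψ) μ‖ = 1 := by
  unfold archTau
  rw [norm_mul, norm_inv, norm_archHeckeValue_eq_one_of_isUnit L hμu (isUnit_archGammaTwo L (γH ψ)),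
    norm_archHeckeValue_eq_one_of_isUnit L hμu (isUnit_archTauArg_centralCurve_of_cos_ne_one L z₀ c γH hγH w₀ hc hcen hreg hψ), inv_one, mul_one]

include hγH in
open scoped Classical in
/-- **THE MOVING∕FROZEN SPLIT**: for `cos(c_{w₀}ψ) ≠ 1`, `μ_∞(t(ψ)) = K₀ · g_{w₀}(2cos(c_{w₀}ψ) − 2)` with `K₀ = ∏_{w ≠ w₀} F_w(t_w)` INDEPENDENT of `ψ` (`t_w = −(u_w − z₀,w,0)(u_w − z₀,w,2)∕(z₀,w,0 z₀,w,2)`,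
★ G1) — place factorisation ★ `archHeckeValue_eq_prod_single`. [cite: Rogawski1990, §8.2 p. 123; §4.9 p. 55] -/
theorem archHeckeValue_archTauArg_centralCurve_eq (hc : ∀ w, w ≠ w₀ → c w = 0) (hcen : z₀ w₀ 0 = z₀ w₀ 1 ∧ z₀ w₀ 2 = z₀ w₀ 1)
    (hreg : ∀ w, w ≠ w₀ → z₀ w 1 ≠ z₀ w 0 ∧ z₀ w 1 ≠ z₀ w 2) {ψ : ℝ} (hψ : Real.cos (c w₀ * ψ) ≠ 1) :
    archHeckeValue L μ (archTauArg L (γH ψ)) =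
      (∏ w ∈ Finset.univ.erase w₀, archHeckeValue L μ (((fun _ => 1, Pi.mulSingle w
          (-(((z₀ w 1 : ℂ) - z₀ w 0) * ((z₀ w 1 : ℂ) - z₀ w 2)) * ((z₀ w 0 : ℂ) * z₀ w 2)⁻¹)) : mixedEmbedding.mixedSpace L))) *
        archHeckeValue L μ (((fun _ => 1, Pi.mulSingle w₀ (((2 * Real.cos (c w₀ * ψ) - 2 : ℝ) : ℂ))) : mixedEmbedding.mixedSpace L)) := by
  rw [archHeckeValue_eq_prod_single L μ (isUnit_archTauArg_centralCurve_of_cos_ne_one L z₀ c γH hγH w₀ hc hcen hreg hψ),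
    ← Finset.prod_erase_mul _ _ (Finset.mem_univ w₀)]
  congr 1
  · refine Finset.prod_congr rfl fun w hw => ?_
    rw [← UnitaryGroup.evalC_apply, evalC_archTauArg_centralCurve_of_ne L z₀ c γH hγH w₀ hc ψ (Finset.ne_of_mem_erase hw)]
  · rw [← UnitaryGroup.evalC_apply, evalC_archTauArg_centralCurve_self L z₀ c γH hγH w₀ hcen ψ, Complex.ofReal_sub, Complex.ofReal_mul,
      Complex.ofReal_ofNat]

omit [IsCMField L] in
open scoped Classical in
/-- The frozen factor `K₀ = ∏_{w ≠ w₀} F_w(t_w)` has norm one for unitary `μ` (each `t_w` is a unit by `(G,H)`-regularity at `w`). [cite: TateThesis1967, §2.3] -/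
theorem norm_prod_archHeckeValue_centralCurve_eq_one (hμu : μ.IsUnitary) (hreg : ∀ w, w ≠ w₀ → z₀ w 1 ≠ z₀ w 0 ∧ z₀ w 1 ≠ z₀ w 2) :
    ‖∏ w ∈ Finset.univ.erase w₀, archHeckeValue L μ (((fun _ => 1, Pi.mulSingle w
        (-(((z₀ w 1 : ℂ) - z₀ w 0) * ((z₀ w 1 : ℂ) - z₀ w 2)) * ((z₀ w 0 : ℂ) * z₀ w 2)⁻¹)) : mixedEmbedding.mixedSpace L))‖ = 1 := by
  rw [norm_prod]
  refine Finset.prod_eq_one fun w hw => norm_archHeckeValue_single_eq_one L μ w hμu ?_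
  have h := hreg w (Finset.ne_of_mem_erase hw)
  refine mul_ne_zero (neg_ne_zero.mpr (mul_ne_zero (sub_ne_zero.mpr fun e => h.1 (Circle.ext e)) (sub_ne_zero.mpr fun e => h.2 (Circle.ext e)))) ?_
  exact inv_ne_zero (mul_ne_zero (Circle.coe_ne_zero _) (Circle.coe_ne_zero _))

/-- `cos(c ψ) ≠ 1` is an open condition. [folklore] -/
private theorem eventually_cos_ne_one {c₀ ψ₀ : ℝ} (h : Real.cos (c₀ * ψ₀) ≠ 1) : ∀ᶠ ψ in 𝓝 ψ₀, Real.cos (c₀ * ψ) ≠ 1 :=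
  ((Real.continuous_cos.comp (continuous_const.mul continuous_id)).continuousAt (x := ψ₀)).eventually_ne h

/-- `s(ψ) = 2cos(c ψ) − 2` has derivative `−2c sin(c ψ)`. [folklore] -/
private theorem hasDerivAt_two_mul_cos_sub_two (c₀ ψ₀ : ℝ) :
    HasDerivAt (fun ψ : ℝ => 2 * Real.cos (c₀ * ψ) - 2) (-(2 * c₀ * Real.sin (c₀ * ψ₀))) ψ₀ := by
  have h := (((Real.hasDerivAt_cos (c₀ * ψ₀)).comp ψ₀ ((hasDerivAt_id ψ₀).const_mul c₀)).const_mul 2).sub_const 2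
  have he : (2 : ℝ) * (-Real.sin (c₀ * ψ₀) * (c₀ * 1)) = -(2 * c₀ * Real.sin (c₀ * ψ₀)) := by ring
  rw [he] at h
  exact h

include hγH in
open scoped Classical in
/-- **`τ` IS DIFFERENTIABLE at every `ψ₀` with `cos(c_{w₀}ψ₀) ≠ 1`, WITH THE DERIVATIVE BOUND `‖∂_ψ τ‖ ≤ ‖g′_{w₀}(1)‖ · |2 c_{w₀} sin(c_{w₀}ψ₀)| ∕ (2 − 2cos(c_{w₀}ψ₀))`** (unitary `μ`): from
the split `τ = μ_∞(u) ∕ (K₀ · g_{w₀}(2cos(cψ) − 2))` near `ψ₀` (`u` does not move: ★ `archGammaTwo_archSingularCurveH_eq`), the chain rule, and §1–§2 (`‖g′(s)‖ = ‖g′(1)‖∕|s|`, all moduli `1`).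
[cite: Rogawski1990, §14.5 p. 238; §8.2 (8.2.1) p. 123] -/
theorem differentiableAt_archTau_centralCurve_and_norm_deriv_le (hμu : μ.IsUnitary) (hc : ∀ w, w ≠ w₀ → c w = 0)
    (hcen : z₀ w₀ 0 = z₀ w₀ 1 ∧ z₀ w₀ 2 = z₀ w₀ 1) (hreg : ∀ w, w ≠ w₀ → z₀ w 1 ≠ z₀ w 0 ∧ z₀ w 1 ≠ z₀ w 2) {ψ₀ : ℝ} (hψ₀ : Real.cos (c w₀ * ψ₀) ≠ 1) :
    DifferentiableAt ℝ (fun ψ => archTau L (γH ψ) μ) ψ₀ ∧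
      ‖deriv (fun ψ => archTau L (γH ψ) μ) ψ₀‖ ≤
        ‖deriv (fun r : ℝ => archHeckeValue L μ (((fun _ => 1, Pi.mulSingle w₀ ((r : ℂ))) : mixedEmbedding.mixedSpace L))) 1‖ *
          |2 * c w₀ * Real.sin (c w₀ * ψ₀)| / (2 - 2 * Real.cos (c w₀ * ψ₀)) := by
  -- names: the constant numerator `A = μ_∞(u)`, the frozen factor `K₀`, the real place factor `g`, the moving argument `s`
  set A : ℂ := archHeckeValue L μ (archGammaTwo L (γH 0)) with hA
  set K₀ : ℂ := ∏ w ∈ Finset.univ.erase w₀, archHeckeValue L μ (((fun _ => 1, Pi.mulSingle w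
      (-(((z₀ w 1 : ℂ) - z₀ w 0) * ((z₀ w 1 : ℂ) - z₀ w 2)) * ((z₀ w 0 : ℂ) * z₀ w 2)⁻¹)) : mixedEmbedding.mixedSpace L)) with hK₀
  set g : ℝ → ℂ := fun r : ℝ => archHeckeValue L μ (((fun _ => 1, Pi.mulSingle w₀ ((r : ℂ))) : mixedEmbedding.mixedSpace L)) with hg
  set s : ℝ → ℝ := fun ψ => 2 * Real.cos (c w₀ * ψ) - 2 with hs
  have hs0 : ∀ {ψ : ℝ}, Real.cos (c w₀ * ψ) ≠ 1 → s ψ ≠ 0 := fun {ψ} h => by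
    rw [hs]; intro h0; apply h; linarith
  have hK₀n : ‖K₀‖ = 1 := norm_prod_archHeckeValue_centralCurve_eq_one L z₀ w₀ μ hμu hreg
  have hAn : ‖A‖ = 1 := norm_archHeckeValue_eq_one_of_isUnit L hμu (isUnit_archGammaTwo L (γH 0))
  -- `τ = A / (K₀ * g (s ψ))` near `ψ₀`
  have hτ : (fun ψ => archTau L (γH ψ) μ) =ᶠ[𝓝 ψ₀] fun ψ => A / (K₀ * g (s ψ)) := by
    filter_upwards [eventually_cos_ne_one hψ₀] with ψ hψ
    unfold archTau
    rw [archGammaTwo_archSingularCurveH_eq L z₀ c γH hγH ψ, archHeckeValue_archTauArg_centralCurve_eq L z₀ c γH hγH w₀ μ hc hcen hreg hψ,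
      div_eq_mul_inv]
  -- derivative of the denominator
  have hgd : HasDerivAt g (deriv g (s ψ₀)) (s ψ₀) :=
    (differentiableAt_archHeckeValue_single_ofReal L μ w₀ (hs0 hψ₀)).hasDerivAt
  have hD : HasDerivAt (fun ψ => K₀ * g (s ψ)) (K₀ * ((-(2 * c w₀ * Real.sin (c w₀ * ψ₀))) • deriv g (s ψ₀))) ψ₀ :=
    (hgd.scomp ψ₀ (hasDerivAt_two_mul_cos_sub_two (c w₀) ψ₀)).const_mul K₀
  have hD0 : K₀ * g (s ψ₀) ≠ 0 := by
    refine mul_ne_zero (norm_ne_zero_iff.mp (by rw [hK₀n]; exact one_ne_zero)) (norm_ne_zero_iff.mp ?_)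
    rw [norm_archHeckeValue_single_eq_one L μ w₀ hμu (Complex.ofReal_ne_zero.mpr (hs0 hψ₀))]; exact one_ne_zero
  have hquot : HasDerivAt (fun ψ => A / (K₀ * g (s ψ)))
      ((0 * (K₀ * g (s ψ₀)) - A * (K₀ * ((-(2 * c w₀ * Real.sin (c w₀ * ψ₀))) • deriv g (s ψ₀)))) / (K₀ * g (s ψ₀)) ^ 2) ψ₀ :=
    (hasDerivAt_const ψ₀ A).div hD hD0
  have hderτ := hquot.congr_of_eventuallyEq hτ
  refine ⟨hderτ.differentiableAt, ?_⟩
  rw [hderτ.deriv]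
  -- norms: every modulus is `1`, `‖g′(s)‖ = ‖g′(1)‖ / |s|`
  have hgsn : ‖g (s ψ₀)‖ = 1 := norm_archHeckeValue_single_eq_one L μ w₀ hμu (Complex.ofReal_ne_zero.mpr (hs0 hψ₀))
  have hg' : ‖deriv g (s ψ₀)‖ = ‖deriv g 1‖ / |s ψ₀| := norm_deriv_archHeckeValue_single_ofReal L μ w₀ hμu (hs0 hψ₀)
  have hspos : 0 < -s ψ₀ := by
    have h1 : Real.cos (c w₀ * ψ₀) < 1 := lt_of_le_of_ne (Real.cos_le_one _) hψ₀
    rw [hs]; linarith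
  have hsabs : |s ψ₀| = 2 - 2 * Real.cos (c w₀ * ψ₀) := by rw [abs_of_neg (by linarith), hs]; ring
  rw [zero_mul, zero_sub, norm_div, norm_neg, norm_mul, norm_mul, norm_pow, norm_mul, hAn, hK₀n, hgsn, one_mul, one_mul, mul_one, one_pow, div_one,
    norm_smul, Real.norm_eq_abs, hg', hsabs, mul_div_assoc', mul_comm, abs_neg]

include hγH in
/-- **`ψ ↦ τ(γ_H(ψ))` is differentiable at every `ψ₀` with `cos(c_{w₀}ψ₀) ≠ 1`** (in particular on a punctured neighbourhood of `0`). [cite: Rogawski1990, §8.2 (8.2.1) p. 123] -/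
theorem differentiableAt_archTau_centralCurve (hμu : μ.IsUnitary) (hc : ∀ w, w ≠ w₀ → c w = 0)
    (hcen : z₀ w₀ 0 = z₀ w₀ 1 ∧ z₀ w₀ 2 = z₀ w₀ 1) (hreg : ∀ w, w ≠ w₀ → z₀ w 1 ≠ z₀ w 0 ∧ z₀ w 1 ≠ z₀ w 2) {ψ₀ : ℝ} (hψ₀ : Real.cos (c w₀ * ψ₀) ≠ 1) :
    DifferentiableAt ℝ (fun ψ => archTau L (γH ψ) μ) ψ₀ :=
  (differentiableAt_archTau_centralCurve_and_norm_deriv_le L z₀ c γH hγH w₀ μ hμu hc hcen hreg hψ₀).1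

/-- Near `0`, `0 < |ψ|` and `|c ψ| ≤ π∕2` give `cos(c ψ) ≠ 1` (for `c ≠ 0`). [folklore] -/
private theorem cos_ne_one_of_abs_le {c₀ ψ : ℝ} (hc₀ : c₀ ≠ 0) (hψ : ψ ≠ 0) (h : |c₀ * ψ| ≤ π / 2) : Real.cos (c₀ * ψ) ≠ 1 := by
  intro h1
  rw [Real.cos_eq_one_iff] at h1
  obtain ⟨n, hn⟩ := h1
  have hx0 : c₀ * ψ ≠ 0 := mul_ne_zero hc₀ hψ
  have hn0 : n ≠ 0 := by rintro rfl; apply hx0; rw [← hn]; simp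
  have h1 : (1 : ℝ) ≤ |(n : ℝ)| := by exact_mod_cast Int.one_le_abs hn0
  have habs : |c₀ * ψ| = |(n : ℝ)| * (2 * π) := by rw [← hn, abs_mul, abs_of_pos (by positivity : (0 : ℝ) < 2 * π)]
  nlinarith [Real.pi_pos, habs, h]

include hγH in
open scoped Classical in
/-- **THE BOUND `‖∂_ψ τ‖ ≤ C ∕ |ψ|` ON A PUNCTURED NEIGHBOURHOOD OF `0`** (`C = π·‖g′_{w₀}(1)‖`, unitary `μ`, `c_{w₀} ≠ 0`): `|2c sin(cψ)|∕(2 − 2cos(cψ)) = |c|·|sin x|∕(1−cos x) ≤ |c|·π∕|x| = π∕|ψ|`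
(`x = cψ`, §1 `abs_sin_div_one_sub_cos_le`) — the `C∕|ψ|` of the R3 census (M3). [cite: Rogawski1990, §14.5 p. 238; §8.2 (8.2.1) p. 123] -/
theorem norm_deriv_archTau_centralCurve_le (hμu : μ.IsUnitary) (hc₀ : c w₀ ≠ 0) (hc : ∀ w, w ≠ w₀ → c w = 0)
    (hcen : z₀ w₀ 0 = z₀ w₀ 1 ∧ z₀ w₀ 2 = z₀ w₀ 1) (hreg : ∀ w, w ≠ w₀ → z₀ w 1 ≠ z₀ w 0 ∧ z₀ w 1 ≠ z₀ w 2) :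
    ∀ᶠ ψ in 𝓝[≠] (0 : ℝ), ‖deriv (fun ψ => archTau L (γH ψ) μ) ψ‖ ≤
      Real.pi * ‖deriv (fun r : ℝ => archHeckeValue L μ (((fun _ => 1, Pi.mulSingle w₀ ((r : ℂ))) : mixedEmbedding.mixedSpace L))) 1‖ / |ψ| := by
  -- the punctured neighbourhood `{ψ ≠ 0, |c ψ| ≤ π/2}`
  have hsmall : ∀ᶠ ψ in 𝓝 (0 : ℝ), |c w₀ * ψ| ≤ π / 2 := by
    have hcont : ContinuousAt (fun ψ : ℝ => |c w₀ * ψ|) 0 := (continuous_abs.comp (continuous_const.mul continuous_id)).continuousAt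
    have h0 : |c w₀ * (0 : ℝ)| < π / 2 := by rw [mul_zero, abs_zero]; positivity
    exact (hcont.eventually (gt_mem_nhds h0)).mono fun ψ hψ => hψ.le
  filter_upwards [mem_nhdsWithin_of_mem_nhds hsmall, self_mem_nhdsWithin] with ψ hψ hψ0
  rw [Set.mem_compl_iff, Set.mem_singleton_iff] at hψ0
  have hcos : Real.cos (c w₀ * ψ) ≠ 1 := cos_ne_one_of_abs_le hc₀ hψ0 hψ
  have hx0 : c w₀ * ψ ≠ 0 := mul_ne_zero hc₀ hψ0
  refine (differentiableAt_archTau_centralCurve_and_norm_deriv_le L z₀ c γH hγH w₀ μ hμu hc hcen hreg hcos).2.trans ?_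
  -- `‖g′(1)‖ · |2c sin x| / (2 − 2cos x) ≤ π ‖g′(1)‖ / |ψ|`
  set G : ℝ := ‖deriv (fun r : ℝ => archHeckeValue L μ (((fun _ => 1, Pi.mulSingle w₀ ((r : ℂ))) : mixedEmbedding.mixedSpace L))) 1‖ with hG
  have hG0 : 0 ≤ G := norm_nonneg _
  have hcos1 : 0 < 1 - Real.cos (c w₀ * ψ) := by
    have := lt_of_le_of_ne (Real.cos_le_one (c w₀ * ψ)) hcos; linarith
  have htrig := abs_sin_div_one_sub_cos_le hx0 hψ
  have hkey : |2 * c w₀ * Real.sin (c w₀ * ψ)| / (2 - 2 * Real.cos (c w₀ * ψ)) = |c w₀| * (|Real.sin (c w₀ * ψ)| / (1 - Real.cos (c w₀ * ψ))) := by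
    rw [abs_mul, abs_mul, abs_two]
    field_simp
  rw [mul_div_assoc, hkey]
  calc G * (|c w₀| * (|Real.sin (c w₀ * ψ)| / (1 - Real.cos (c w₀ * ψ))))
      ≤ G * (|c w₀| * (π / |c w₀ * ψ|)) := by gcongr
    _ = Real.pi * G / |ψ| := by
        rw [abs_mul]
        have hc' : |c w₀| ≠ 0 := abs_ne_zero.mpr hc₀
        field_simp

end Curve

end Literature.NumberTheory.Rogawski1990

end
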